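import Summits.NavierStokesRegularity.NavierStokesRegularity.Theses.QuantisedSymmetry
import Summits.NavierStokesRegularity.NavierStokesRegularity.Theorems.QuantisedSymmetryPolyhedralTruncationBridge
import Summits.NavierStokesRegularity.NavierStokesRegularity.Theorems.QuantisedSymmetryLiouvilleKillsProfile
import Summits.NavierStokesRegularity.NavierStokesRegularity.Theorems.SoloInformedClayDichotomy
import Literature.Analysis.FluidPDE.SelfSimilar
import HarnessLib

/-!
# Strategist sketch S19-g8 (family `-s`, independent census) for crux
`QuantisedSymmetry.PolyhedralDssProfileExists` (stmt-NavierStokesRegularity-1404)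

Typed companions of `STRATEGY-CENSUS-s19.md`:

* §0  `crux_imp_not_summit`, `crux_imp_breakdownC` — the crux ALONE decides the board (both other
  binders of the route's `closes` are tree theorems), so no replacement that still feeds `closes`
  can be short of `¬ NavierStokesRegularity`.
* §1  `NotPolyhedralLiouville` (W2) — the one strictly-weaker-looking intermediate, with
  `notPolyhedralLiouville_of_crux` (C ⇒ W2, from the landed kill-switch lemma).
* §2  `Periodisation` and the PROVED assembly `crux_of_subs : W2 → Periodisation → C` (decomposition
  D3 of the census; recorded, not filed — see the census for why it has no teeth).
* §4  `SelfSimilarPolyhedralProfileExists` (S⁺ = continuous self-similarity), `s_plus_imp_crux`;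
  S⁺ is refuted in print (Nečas–Růžička–Šverák 1996 / Tsai 1998 = Literature facts
  `necas_ruzicka_sverak`, `tsai_selfsimilar_local_energy`, ns.S21).

Nothing here is a registered line: no `stub_*`, no sorry.
-/

set_option linter.dupNamespace false

namespace Summit.NavierStokesRegularity.NavierStokesRegularity.Cruxes.PolyhedralDssProfileExists.StrategistS19g8

open MeasureTheory Set Filter
open Literature.Analysis.FluidPDE
open Summit.NavierStokesRegularity.NavierStokesRegularity.Theses.QuantisedSymmetry

local notation "ℝ³" => EuclideanSpace ℝ (Fin 3)

/-! ## §0 The crux alone decides ¬(A) (and hence Clay (C)) -/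

/-- `PolyhedralDssProfileExists → ¬ NavierStokesRegularity`: the route's deciding theorem `closes`
with its two other binders discharged by tree theorems (`PolyhedralTruncationBridge` proved by
`quantisedSymmetry_polyhedralTruncationBridge_proof`, `ClayUniqueness_holds`). -/
theorem crux_imp_not_summit : PolyhedralDssProfileExists → ¬ _root_.NavierStokesRegularity :=
  fun h => closes h Theorems.quantisedSymmetry_polyhedralTruncationBridge_proof ClayUniqueness_holds

/-- … and therefore Clay (C) (forced breakdown on `ℝ³`), by the landed dichotomy (A) ∨ (C). So even
the weakest board-closing target, (C), is not "short of the summit" for this crux: C ⇒ ¬(A) ⇒ (C). -/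
theorem crux_imp_breakdownC : PolyhedralDssProfileExists → NavierStokesBreakdownR3 :=
  fun h => (Theorems.navierStokesRegularity_or_breakdownR3).resolve_left (crux_imp_not_summit h)

/-! ## §1 The weaker intermediate W2 = failure of the polyhedral Type-I Liouville theorem -/

/-- W2: in some polyhedral (irreducible finite rotation group) sector there is a NONTRIVIAL bounded
ancient mild solution with Type-I space–time decay — i.e. the route's kill switch
`PolyhedralTypeILiouville` (stmt-1405) FAILS. Weaker than the crux (drop discrete self-similarity);
does NOT feed `closes` (the general, non-DSS ancient truncation bridge is open: route
AncientHullSteering, stmt-20185). -/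
def NotPolyhedralLiouville : Prop := ¬ PolyhedralTypeILiouville

/-- C ⇒ W2 (contrapositive of the landed kill switch `LiouvilleKillsProfile`, stmt-1408). -/
theorem notPolyhedralLiouville_of_crux : PolyhedralDssProfileExists → NotPolyhedralLiouville :=
  fun hC hL => Theorems.quantisedSymmetry_liouvilleKillsProfile_proof hL hC

/-! ## §2 Decomposition D3: C ⇐ W2 ∧ Periodisation (assembly proved; not filed) -/

/-- PERIODISATION (D3, piece 2): in every polyhedral sector, a nontrivial bounded ancient
`G`-equivariant Type-I-decay mild solution yields a nontrivial `λ`-DSS one (some `λ > 1`) in the same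
sector. Dynamical reading: the backward similarity flow restricted to the `G`-sector, started on the
(compact, `0 ∌`) α-limit set of the given ancient orbit, has a periodic orbit. No engine known
(non-variational flow, no Poincaré–Bendixson in infinite dimensions); plausibly false as a ∀-statement. -/
def Periodisation : Prop :=
  ∀ G : Subgroup (ℝ³ ≃ₗᵢ[ℝ] ℝ³), Finite G →
    (∀ g ∈ G, LinearMap.det (g.toLinearEquiv : ℝ³ →ₗ[ℝ] ℝ³) = 1) →
    (∀ V : Submodule ℝ ℝ³, (∀ g ∈ G, ∀ v ∈ V, g v ∈ V) → V = ⊥ ∨ V = ⊤) →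
    (∃ u : ℝ → ℝ³ → ℝ³, IsBoundedAncientMildSolution 1 u ∧ (∀ t < 0, AEStronglyMeasurable (u t) volume) ∧
      (∃ C₀ : ℝ, HasTypeIDecay C₀ u) ∧ (∀ g ∈ G, ∀ t x, u t (g x) = g (u t x)) ∧ ¬ (∀ t < 0, u t =ᵐ[volume] 0)) →
    ∃ c : ℝ, 1 < c ∧ ∃ u : ℝ → ℝ³ → ℝ³, IsAncientMildSolution 1 u ∧ (∀ t < 0, AEStronglyMeasurable (u t) volume) ∧
      IsDiscretelySelfSimilar c u ∧ (∃ C₀ : ℝ, HasTypeIDecay C₀ u) ∧ (∀ g ∈ G, ∀ t x, u t (g x) = g (u t x)) ∧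
      ¬ (∀ t < 0, u t =ᵐ[volume] 0)

/-- The D3 assembly `W2 → Periodisation → C`, sorry-free (pure logic). -/
theorem crux_of_subs (h1 : NotPolyhedralLiouville) (h2 : Periodisation) : PolyhedralDssProfileExists := by
  classical
  by_contra hC
  apply h1
  intro G hfin hdet hirr u hu hmeas hdec heqv
  by_contra hnt
  obtain ⟨c, hc, w, hanc, hmeas', hdss, hdec', heqv', hnt'⟩ :=
    h2 G hfin hdet hirr ⟨u, hu, hmeas, hdec, heqv, hnt⟩
  exact hC ⟨G, hfin, hdet, hirr, c, hc, w, hanc, hmeas', hdss, hdec', heqv', hnt'⟩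

/-! ## §4 Strengthening S⁺ = continuous self-similarity (refuted in print) -/

/-- S⁺: a polyhedrally equivariant, Type-I-decay, nontrivial ancient mild solution that is
SELF-SIMILAR for every factor (Leray 1934). Implies the crux (take `λ = 2`); refuted by
Nečas–Růžička–Šverák 1996 / Tsai 1998 (Literature ns.S21: `necas_ruzicka_sverak`,
`tsai_selfsimilar_local_energy`; barrier `LeraySelfSimilarBlowupExclusion`). -/
def SelfSimilarPolyhedralProfileExists : Prop :=
  ∃ G : Subgroup (ℝ³ ≃ₗᵢ[ℝ] ℝ³), Finite G ∧
    (∀ g ∈ G, LinearMap.det (g.toLinearEquiv : ℝ³ →ₗ[ℝ] ℝ³) = 1) ∧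
    (∀ V : Submodule ℝ ℝ³, (∀ g ∈ G, ∀ v ∈ V, g v ∈ V) → V = ⊥ ∨ V = ⊤) ∧
    ∃ u : ℝ → ℝ³ → ℝ³, IsAncientMildSolution 1 u ∧ (∀ t < 0, AEStronglyMeasurable (u t) volume) ∧
      IsSelfSimilar u ∧ (∃ C₀ : ℝ, HasTypeIDecay C₀ u) ∧ (∀ g ∈ G, ∀ t x, u t (g x) = g (u t x)) ∧
      ¬ (∀ t < 0, u t =ᵐ[volume] 0)

/-- S⁺ ⇒ C with `λ = 2`. -/
theorem s_plus_imp_crux : SelfSimilarPolyhedralProfileExists → PolyhedralDssProfileExists := by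
  rintro ⟨G, hfin, hdet, hirr, u, hanc, hmeas, hss, hdec, heqv, hnt⟩
  exact ⟨G, hfin, hdet, hirr, 2, by norm_num, u, hanc, hmeas,
    hss.isDiscretelySelfSimilar (by norm_num), hdec, heqv, hnt⟩

end Summit.NavierStokesRegularity.NavierStokesRegularity.Cruxes.PolyhedralDssProfileExists.StrategistS19g8
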